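import Summits.Ventures.PercRepro.S1JointPerFlat3
import Summits.Ventures.PercRepro.S1YSide

/-!
# PercRepro — S1 THE `Y`-SIDE WITH LEMMA K: `midCount_ge` with `R₄ = RSK 10·Π′_all + (RBK 10 − RSK 10)·Π′_{S₀}` (p2, gen 15; SUBCLAIM-S1 §5)

`S1JointYSide2.midCount_ge_joint'` with `S1JointPerFlat3.ncard_rank4_Icc_le_K` at `c = 10` (the Lemma-K weights in
place of the weights of `S1PairInjection`). The proof of `midCount_ge` is repeated with this bound.

* `ncard_rankEq4_ge_five_le_K` — (Y2) with the Lemma-K weights;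
* **`midCount_ge_K`** — (Y1) with `R₄` in that form.
Axioms: standard.
-/

open scoped Matroid

namespace PercRepro

namespace S1

open Set

variable {α : Type}

/-- **(Y2), LEMMA-K FORM**: `7560·#{A ⊆ E : r(A) = 4, |A| ≥ 5} ≤ RS 10·Π′_all + (RB 10 − RS 10)·Π′_{S₀}`. -/
theorem ncard_rankEq4_ge_five_le_K (M : Matroid α) [M.Finite]
    (hcirc : ∀ C, M.IsCircuit C → 3 ≤ C.encard)
    (hline : ∀ L ⊆ M.E, M.eRk L ≤ 2 → L.ncard ≤ 3) (hplane : ∀ P ⊆ M.E, M.eRk P ≤ 3 → P.ncard ≤ 6)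
    (hten : ∀ X ⊆ M.E, M.eRk X ≤ 4 → X.ncard ≤ 10) {d : ℕ} (hd : M.E.encard = M.eRank + d) :
    7560 * {A : Set α | A ⊆ M.E ∧ M.eRk A = 4 ∧ 5 ≤ A.ncard}.ncard ≤
      RSK 10 * ({C : Set α | M.IsCircuit C ∧ C.ncard = 3}.ncard * (M.E.ncard - 3).choose 2 +
        {C : Set α | M.IsCircuit C ∧ C.ncard = 4}.ncard * (M.E.ncard - 4) +
        {C : Set α | M.IsCircuit C ∧ C.ncard = 5}.ncard) +
      (RBK 10 - RSK 10) * ({C : Set α | M.IsCircuit C ∧ C.ncard = 3}.ncard * (min (5 * d) M.E.ncard - 3).choose 2 +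
        {C : Set α | M.IsCircuit C ∧ C.ncard = 4}.ncard * (min (5 * d) M.E.ncard - 4) +
        {C : Set α | M.IsCircuit C ∧ C.ncard = 5}.ncard) := by
  have hcore := ncard_rank4_Icc_le_K M hcirc hline hplane hten hd 10
  have heq : {A : Set α | A ⊆ M.E ∧ M.eRk A = 4 ∧ 5 ≤ A.ncard} =
      {B : Set α | B ⊆ M.E ∧ M.eRk B = 4 ∧ 5 ≤ B.ncard ∧ B.ncard ≤ 10} := by
    ext A
    simp only [Set.mem_setOf_eq]
    constructor
    · rintro ⟨hAE, hr, h5⟩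
      exact ⟨hAE, hr, h5, hten A hAE hr.le⟩
    · rintro ⟨hAE, hr, h5, -⟩
      exact ⟨hAE, hr, h5⟩
  rw [heq]
  exact hcore

/-- **(Y1) THE `Y`-SIDE, LEMMA-K FORM**: `7560·Σ_{j=5}^{p−1} C(n, j) ≤ 7560·#Y(p, 4) + 7560·22·(s₃(n − 3) + s₄) +
RS 10·Π′_all + (RB 10 − RS 10)·Π′_{S₀}`. -/
theorem midCount_ge_K (M : Matroid α) [M.Finite]
    (hcirc : ∀ C, M.IsCircuit C → 3 ≤ C.encard)
    (hline : ∀ L ⊆ M.E, M.eRk L ≤ 2 → L.ncard ≤ 3) (hplane : ∀ P ⊆ M.E, M.eRk P ≤ 3 → P.ncard ≤ 6)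
    (hten : ∀ X ⊆ M.E, M.eRk X ≤ 4 → X.ncard ≤ 10) {d : ℕ} (hd : M.E.encard = M.eRank + d) (p : ℕ) :
    7560 * ∑ j ∈ Finset.Ico 5 p, M.E.ncard.choose j ≤
      7560 * Matroid.midCount M p 4 +
      7560 * 22 * ({C : Set α | M.IsCircuit C ∧ C.ncard = 3}.ncard * (M.E.ncard - 3) +
        {C : Set α | M.IsCircuit C ∧ C.ncard = 4}.ncard) +
      (RSK 10 * ({C : Set α | M.IsCircuit C ∧ C.ncard = 3}.ncard * (M.E.ncard - 3).choose 2 +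
        {C : Set α | M.IsCircuit C ∧ C.ncard = 4}.ncard * (M.E.ncard - 4) +
        {C : Set α | M.IsCircuit C ∧ C.ncard = 5}.ncard) +
      (RBK 10 - RSK 10) * ({C : Set α | M.IsCircuit C ∧ C.ncard = 3}.ncard * (min (5 * d) M.E.ncard - 3).choose 2 +
        {C : Set α | M.IsCircuit C ∧ C.ncard = 4}.ncard * (min (5 * d) M.E.ncard - 4) +
        {C : Set α | M.IsCircuit C ∧ C.ncard = 5}.ncard)) := by
  classical
  have hY3 := ncard_rankLe3_ge_five_le M hcirc hline hplane
  have hY2 := ncard_rankEq4_ge_five_le_K M hcirc hline hplane hten hd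
  set Ef := M.ground_finite.toFinset with hEf
  have hEcard : Ef.card = M.E.ncard := (Set.ncard_eq_toFinset_card _ M.ground_finite).symm
  -- the sets with `5 ≤ |A| ≤ p − 1`: exactly `Σ_{j ∈ Ico 5 p} C(n, j)` of them
  set 𝓑 : ℕ → Finset (Set α) := fun j => (Ef.powersetCard j).image (fun s : Finset α => (s : Set α)) with h𝓑
  have h𝓑card : ∀ j, (𝓑 j).card = M.E.ncard.choose j := fun j => by
    rw [h𝓑]; exact card_image_powersetCard M.ground_finite j
  have hmem𝓑 : ∀ j A, A ∈ 𝓑 j ↔ A ⊆ M.E ∧ A.ncard = j := fun j A =>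
    mem_image_powersetCard_iff M.ground_finite j A
  have hdisj : ((Finset.Ico 5 p : Finset ℕ) : Set ℕ).PairwiseDisjoint 𝓑 := by
    intro i _ j _ hij
    rw [Function.onFun, Finset.disjoint_left]
    intro A hA hA'
    rw [hmem𝓑] at hA hA'
    exact hij (hA.2.symm.trans hA'.2)
  set W := (Finset.Ico 5 p).biUnion 𝓑 with hW
  have hWcard : W.card = ∑ j ∈ Finset.Ico 5 p, M.E.ncard.choose j := by
    rw [hW, Finset.card_biUnion hdisj]
    exact Finset.sum_congr rfl (fun j _ => h𝓑card j)
  -- `W ⊆ Y ∪ T₃ ∪ T₄`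
  set Y := {A : Set α | A ⊆ M.E ∧ (4 : ℕ∞) < M.eRk A ∧ M.eRk A < (p : ℕ∞)} with hY
  set T₃ := {A : Set α | A ⊆ M.E ∧ M.eRk A ≤ 3 ∧ 5 ≤ A.ncard} with hT₃
  set T₄ := {A : Set α | A ⊆ M.E ∧ M.eRk A = 4 ∧ 5 ≤ A.ncard} with hT₄
  have hsub : (W : Set (Set α)) ⊆ Y ∪ T₃ ∪ T₄ := by
    intro A hA
    rw [Finset.mem_coe, hW, Finset.mem_biUnion] at hA
    obtain ⟨j, hj, hAj⟩ := hA
    rw [Finset.mem_Ico] at hj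
    rw [hmem𝓑] at hAj
    obtain ⟨hAE, hAcard⟩ := hAj
    have hAfin : A.Finite := M.ground_finite.subset hAE
    have hlt : M.eRk A < (p : ℕ∞) := by
      calc M.eRk A ≤ A.encard := M.eRk_le_encard A
        _ = (A.ncard : ℕ∞) := hAfin.cast_ncard_eq.symm
        _ < (p : ℕ∞) := by rw [hAcard]; exact_mod_cast hj.2
    by_cases h4 : (4 : ℕ∞) < M.eRk A
    · exact Or.inl (Or.inl ⟨hAE, h4, hlt⟩)
    · push Not at h4
      rcases h4.lt_or_eq with h | h
      · have h3 : M.eRk A ≤ 3 := by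
          have : M.eRk A < (3 : ℕ∞) + 1 := by rw [show ((3 : ℕ∞) + 1) = 4 by norm_num]; exact h
          simpa using Order.le_of_lt_add_one this
        exact Or.inl (Or.inr ⟨hAE, h3, by omega⟩)
      · exact Or.inr ⟨hAE, h, by omega⟩
  have hYfin : Y.Finite := M.ground_finite.finite_subsets.subset (fun A hA => hA.1)
  have hT₃fin : T₃.Finite := M.ground_finite.finite_subsets.subset (fun A hA => hA.1)
  have hT₄fin : T₄.Finite := M.ground_finite.finite_subsets.subset (fun A hA => hA.1)
  have hWle : W.card ≤ Y.ncard + T₃.ncard + T₄.ncard := by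
    calc W.card = (W : Set (Set α)).ncard := (Set.ncard_coe_finset _).symm
      _ ≤ (Y ∪ T₃ ∪ T₄).ncard := Set.ncard_le_ncard hsub ((hYfin.union hT₃fin).union hT₄fin)
      _ ≤ (Y ∪ T₃).ncard + T₄.ncard := Set.ncard_union_le _ _
      _ ≤ Y.ncard + T₃.ncard + T₄.ncard := by
          have := Set.ncard_union_le Y T₃
          omega
  have hmid : Matroid.midCount M p 4 = Y.ncard := rfl
  rw [← hWcard, hmid]
  have hY3' : T₃.ncard ≤ 22 * ({C : Set α | M.IsCircuit C ∧ C.ncard = 3}.ncard * (M.E.ncard - 3) +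
      {C : Set α | M.IsCircuit C ∧ C.ncard = 4}.ncard) := hY3
  have hY2' : 7560 * T₄.ncard ≤ _ := hY2
  nlinarith [hWle, hY3', hY2']

end S1

end PercRepro
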